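import Mathlib
import Summits.QuantumFields.YangMills.Theses.FemtoCutoffLadder
import Summits.QuantumFields.YangMills.Theorems.FemtoCutoffLadderLocalWallReductions

/-!
# SKELETON «comparisons» for the support `SingleWallStep` (stmt-QuantumFields-26631, route `FemtoCutoffLadder` rev 20; rung R2b1 = RECORD label)

Lead seat `ym-line-fcl-p1` g9 (2026-08-28).  26631 = LINE g5-A's FIRST RUNG (critic idea-crit-4 07:03Z P2 «attack first»): ONE κ-wall at ONE plaquette
`p₀` on the bare femto-window transfer matrix (wall set `Q = ∅`) moves `L·log(s/t)` by `≤ A/(β²N)`, `N = 3L³`, uniformly in `L ≥ L₀(κ)`; if it FAILS,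
`not_localWallStep_of_not_singleWallStep` (p613090) kills the crux 26282.  Positivity clauses unconditional (`walledTop_pos`, p615421) ⇒ ONE stub:
* `stub_singleWallComparisons : SingleWallComparisons` — L–XL: first order in the projector defect is `2L·Cov_vac(1_{bad p₀}, g²)` (`g` = toron
  excitation multiplier); the toron-dependence of a one-plaquette tail event is a winding effect `≍ β^κ h(c) L⁻⁴` ⇒ `δ ≍ β^κ e^{−cβ^κ}/L³ ≪ A/(β²·3L³)`
  (lead g9 heuristic; critic P1 «imprint dichotomy»); a proof needs the femto slow/fast structure of vacuum AND first excitation uniformly in `L`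
  along the window plus a one-defect relative (Kato/Feshbach) bound.
Composition (kernel-checked, in the TREE): `singleWallStep_of_comparisons` (lead g9, p616201).
HONEST FRAMING: OPEN; R2b1 is a RECORD rung — not infinite volume, not a mass gap, not Clay.  No summit is proved by this line.
-/

set_option autoImplicit false

noncomputable section

open Literature.MathematicalPhysics.QuantumFieldTheory hiding SU2
open Summit.QuantumFields.YangMills.Theorems.FemtoTransferGap
open Summit.QuantumFields.YangMills.Theorems.FemtoCutoffLadder
open Summit.QuantumFields.YangMills.Theses.FemtoCutoffLadder

namespace Summit.QuantumFields.YangMills.Cruxes.SingleWallStep.Comparisons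

/-- **The two single-wall comparison clauses** (verbatim the hypothesis of `singleWallStep_of_comparisons`). -/
def SingleWallComparisons : Prop :=
  ∀ κ : ℝ, 0 < κ → κ < 1 → ∃ (A lam0 : ℝ) (L0 : ℕ), 0 ≤ A ∧ 0 < lam0 ∧ ∀ lam : ℝ, 0 < lam → lam ≤ lam0 → ∀ (L : ℕ) [NeZero L], L0 ≤ L → ∀ β : ℝ, InFemtoWindow lam β L → let W : Set (Plaquette 3 L) → (GaugeConfig 3 L SU2 → ℝ) → Prop := fun Q ψ => ∀ U, (∃ p ∈ Q, β ^ (κ - 1) < 2 - (su2Rep (plaquetteHolonomy U p.1 p.2.1.1 p.2.1.2)).trace.re) → ψ U = 0; let t : Set (Plaquette 3 L) → ℝ := fun Q => sSup (rayleighSet su2Rep L β (W Q)); let s : Set (Plaquette 3 L) → ℝ := fun Q => sInf {x : ℝ | ∃ φ : GaugeConfig 3 L SU2 → ℝ, IsPhys φ ∧ x = sSup (rayleighSet su2Rep L β fun ψ => W Q ψ ∧ l2 ψ φ = 0)}; ∀ p₀ : Plaquette 3 L, s ((insert p₀ (∅ : Set (Plaquette 3 L)))) ^ L * t (∅ : Set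 (Plaquette 3 L)) ^ L ≤ Real.exp (A / β ^ 2 / (Fintype.card (Plaquette 3 L) : ℝ)) * (s (∅ : Set (Plaquette 3 L)) ^ L * t ((insert p₀ (∅ : Set (Plaquette 3 L)))) ^ L) ∧ s (∅ : Set (Plaquette 3 L)) ^ L * t ((insert p₀ (∅ : Set (Plaquette 3 L)))) ^ L ≤ Real.exp (A / β ^ 2 / (Fintype.card (Plaquette 3 L) : ℝ)) * (s ((insert p₀ (∅ : Set (Plaquette 3 L)))) ^ L * t (∅ : Set (Plaquette 3 L)) ^ L)

/-- stub (the ONLY one; L–XL): the comparison clauses of `SingleWallStep`. -/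
theorem stub_singleWallComparisons : SingleWallComparisons := by
  sorry

/-- ★ The support `SingleWallStep` BY NAME from exactly the one declared stub (composition p616201). -/
theorem SingleWallStep_holds_of_stubs : SingleWallStep :=
  singleWallStep_of_comparisons stub_singleWallComparisons

end Summit.QuantumFields.YangMills.Cruxes.SingleWallStep.Comparisons

end
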